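import Literature.MathematicalPhysics.QuantumFieldTheory.Balaban1983to89.B6Prop22KLevelCensusEta
import Literature.MathematicalPhysics.QuantumFieldTheory.Balaban1983to89.B6Lemma21PrintedDomains

/-!
# `Balaban1983to89.B6Lemma21R0MultiLevelBox` — [B6] LEMMA 2.1 (2.60)–(2.63) WITH THE d-ONLY CONSTANT c₁″ AND PRINT'S
DISTANCE (2.46) READ LITERALLY (reading R0) ON THE GENUINE `k`-LEVEL BOX FAMILY of seat p21: every nested family
`D : Domains` (2.1)–(2.2) of the box is EXTENDED to print's setting on `ℤ^{d+1}` (nested unions of `LʲM`-cubes with the collar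
(2.2)) by clamping coordinates into the box, its blocks `𝔅` are print's base points, and p29's
`B6Lemma21PrintedDomains.lemma21_printedDomains` (Lemma 2.1 for print's own domains with c₁″ = 13c₀(½α)^{4d}) is pulled back
along the embedding — the «R0 ∕ R1 d-only route» of B6-CLOSURE §5 item 1 for the `DagBinding.B6Lemma21Param` conjunct on the
`k`-level family (no existing module is touched; no fact is minted)

FRAMING (verbatim cell line):
statement-level skeleton of published theorems with citation tags; proofs where landed; nothing here is a claim about the Yang–Mills mass gap

Source under audit (cell pub-balaban / lit-balaban): T. Bałaban, *Propagators and renormalization transformations for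
lattice gauge theories. II*, Commun. Math. Phys. **96** (1984) 223–250 [`Balaban1984PropagatorsII`, "B6"], p. 224 [PDF 2]
(2.1)–(2.4), p. 231 [PDF 9] (2.45)–(2.46), p. 233 [PDF 11] (2.57), (2.59), p. 234 [PDF 12] Lemma 2.1 (2.60)–(2.63) (held text
`paper:balaban1984-cmp96-propagators-rt-ii` p0002, p0009–p0012, re-read this generation).  Unit `lit-balaban-p21` (Phase-2
proof seat p21 gen 14), HOME `run/shared/lean/pub/lit-balaban/`, free-target protocol G.5-34(d), B6 fold owner r03, referee
ref-4; GAPS G-B6-22 (= G-B6-p29-01: the three readings R0 ∕ R1 ∕ R2 of the admissible bonds of (2.46)).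

## WHAT IS PRINTED (verbatim up to notation)

p. 224: «We consider a sequence of domains Ω₁ ⊃ Ω₂ ⊃ … ⊃ Ω_k, Ω_j ⊂ T_η, j = 1, 2, …, k, (2.1) which satisfy the following
conditions: Ω_j = B^j(Ω_j^{(j)}), Ω_j^{(j)} ⊂ T^{(j)}_{L^jη} and it is a sum of big blocks, (L^jη)^{−1}dist(Ω_j^c, Ω_{j+1}) >
RM, M is a size of big blocks and R is a big positive integer which will be fixed later. (2.2) … Let us notice that we admit
the case when some domains Ω_j are equal to T_η, for example Ω_j = T_η for j = 1, 2, …, l, l ≤ k.»  p. 231: «𝔅 = ⋃_{j=0}^k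
Λ_j. (2.45) … We consider a special class of contours Γ. They have the property that a part of Γ contained in B^j(Λ_j)
consists of bonds of the lattice Λ_j. Now we define d(y, y′) = inf_{Γ_{y,y′}} Σ_{j=0}^k (L^jη)^{−1}|Γ_{y,y′} ∩ B^j(Λ_j)|,
y, y′ ∈ 𝔅, (2.46)».  p. 233: «Now we require that RM is sufficiently large, i.e. we assume ¼αδ₀RM > 2d log c₀(½α) + 1.
(2.59)».  p. 234: «**Lemma 2.1.** For the numbers α, 0 < α < 1, c₁(α) = 12c₀^d(½α), and RM satisfying (2.59) we have
e^{−αδ₀d(y,y′)} ≤ e^{−αδ₀RM max{|j−j′|−1,0}}, y ∈ Λ_j, y′ ∈ Λ_{j′}, (2.60)  sup_{y∈𝔅} Σ_{y′∈𝔅} e^{−αδ₀d(y,y′)} ≤ c₁(α),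
(2.61)» and (2.62), (2.63).

## WHAT THIS FILE CERTIFIES (kernel-checked; setting of `B6MultiLevelBoxOperator` / `B6Geom246MultiLevelBox`)

For every nested family `D : Domains d ℓ M_h k P R` on the fine box `X = Π_μ[0, N₀_μ)` (levels `1 … k`, `L = ℓ + 1`, big blocks
of side `M·L^j` with `M = L·M_h`, lattice units):
* §1 the coordinate CLAMP into the box (`clamp`, `clampV`: 1-Lipschitz in the sup norm, the identity on the box, compatible
  with every grid of cubes whose side divides the box sides);
* §2 **THE EXTENSION OF `D` TO PRINT'S SETTING ON `ℤ^{d+1}`**: `levExt D x := lev(clamp x)`, `Ω_j := {j ≤ levExt}`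
  (`OmExt`; `Ω₀ = Ω₁ = ℤ^{d+1}` — print's «Ω_j = T_η for j ≤ l» with `l = 1` —, `Ω_{k+1} = ∅`, antitone), and the two clauses
  of (2.1)–(2.2) IN p29's TYPING: every `Ω_j` is a union of `LʲM`-cubes (`isUnionOfCubes_OmExt`, from `Domains.bigBlocks`)
  and the collar in the sup norm with print's threshold `T = R·M` (`cond22Sup_OmExt`, from `Domains.sep`: the clamp is
  1-Lipschitz, so a violating pair outside the box would clamp to a violating pair inside);
* §3 **`𝔅` OF THE BOX ARE PRINT'S BASE POINTS**: the block `(j, y) ∈ bset D` IS the cube-site `(j, y)` of p29's carrier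
  `CubeSite 1 L Ωᶜ` (`iota`, injective, zone = level) — its `Lʲ`-block lies in the box and in the territory `B^j(Λ_j)`;
* §4 **THE R0 GEOMETRY OF THE BOX** `geomR0 D : B6.Geometry`: p21's `geom D` (sites `𝔅`, scale = level) with `dist :=` the
  distance (2.46) of p29's lattice-contour graph `latC` (print's admissible bonds read literally, reading R0 of G-B6-22)
  between the embedded blocks, and print's parameters `R`, `M = L·M_h`; realised by the contour system
  `⟨CubeSite, latC, iota, zoneC⟩` (`realizes_geomR0`), admissible contours exist (`connected_R0`), the walk form (2.57) of
  the collar with print's `RM` (`levelGap_R0`), the triangle inequality (2.54) (`triangle254_R0`);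
* §5 **LEMMA 2.1 FOR THE GENUINE `k`-LEVEL BOX FAMILY WITH PRINT'S DISTANCE AND THE d-ONLY CONSTANT**
  (`lemma21R0_multiLevelBox`): for `ℓ, M_h, R, P_μ ≥ 1`, every `δ₀ > 0`, every `0 < α < 1` with (2.59)
  `¼αδ₀RM > 2(d+1) log c₀(½α) + 1` FOR PRINT'S `R` AND `M`:  (2.60) `e^{−αδ₀d(y,y′)} ≤ e^{−αδ₀RM·max{|j−j′|−1,0}}` ∧ (2.61″)
  `Σ_{y′∈𝔅} e^{−αδ₀d(y,y′)} ≤ c₁″(α) = 13c₀(½α)^{4(d+1)}` ∧ (2.62″) ∧ (2.63″) — uniformly in `k`, the volume `P`, `M_h`, `R` and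
  the family `D` (p29's `ineq261T_latC_of_sepZd`, `levelGap_printedDomains`, `connected_printedDomains`,
  `tiles_printedDomains` and `B6Geometry.ineq260_of_levelGap` / `triangle254_of_realizes` BY NAME on the extension of §2);
* §6 **THE `B6Lemma21Param` SHAPE ON THE CENSUS FAMILY**: `geoR0P i` = the census geometry `KIdx.geoP i` of
  `B6Prop22KLevelCensusEta` (print's units) with `dist` replaced by the R0 distance, and `lemma21Param_kLevelR0`:
  `∃ c₁ : ℝ → ℝ, ∀ i : KIdx d ℓ, Hyp21_22 → ∀ α ∈ (0,1), Cond259 → Ineq260 ∧ Ineq261With (c₁ α)` with `c₁ = c₁″` — VERBATIM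
  the body of `DagBinding.B6Lemma21Param` on the genuine `k`-level family (every `δ₀ > 0`).

## HONEST SCOPE

* The distance here is print's (2.46) read literally (R0): Λ_j-lattice bonds inside the closure of B^j(Λ_j), typed by p29's
  `B15LatticeCubeContours.latC`; p21's Prop. 2.2 ∕ 2.3 chain (`prop22Printed_kLevelP`, `prop23Printed_kLevelP`) is stated with
  the TOUCHING-block distance of `geom D` (reading R2, `d_R2 ≤ d_R0` pointwise, G-B6-22), under which an `L`-free (2.61)
  constant is impossible; the comparison `d_R0 ≤ κ(d, L)·d_R2` that would move those bounds to `geoR0P` is NOT in this file.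
* The extension of §2 is ours (dictionary): outside the box the level is that of the clamped point; it is ONE nested family of
  print's setting whose restriction to the box is `D` and whose base points inside the box are exactly `𝔅`; Lemma 2.1's sums
  over `𝔅` are the sums of the restricted geometry (sub-sums of print's), its distance the restriction of print's (2.46) on
  the extended family.  `Ω₁ = ℤ^{d+1}` (no level 0), as in the whole `k`-level lane.
* Constant c₁″ = 13c₀(½α)^{4(d+1)} (`B6Lemma21TwoScale.c1TwoScale`, d-only; the lineage's corrected constant); the printed
  c₁(α) = 12c₀(½α)^d stays refuted as typed (`B6Lemma21Counterexample`).  (2.2)'s «dist» in the sup norm of the fine lattice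
  (p21's `Domains.sep`), served by p29's `Cond22Sup`.
* Nothing is inferred from the manuscript: every step is kernel-checked; the quoted sentences locate the statements.
-/

namespace Literature.MathematicalPhysics.QuantumFieldTheory.Balaban1983to89.B6Lemma21R0MultiLevelBox

open Literature.MathematicalPhysics.QuantumFieldTheory.Balaban1983to89
open Literature.MathematicalPhysics.QuantumFieldTheory.Balaban1983to89.B4ContourShift (supNorm abs_le_supNorm
  supNorm_nonneg exists_supNorm_eq)
open Literature.MathematicalPhysics.QuantumFieldTheory.Balaban1983to89.B4Reflection242 (boxDom mem_boxDom blk)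
open Literature.MathematicalPhysics.QuantumFieldTheory.Balaban1983to89.B6MultiLevelBoxOperator (N0 Domains bigSide)
open Literature.MathematicalPhysics.QuantumFieldTheory.Balaban1983to89.B6Geom246MultiLevelBox (bset blkOf geom bond
  exists_blkOf_eq lev_eq_of_blkOf_eq coord_bounds blkOf_eq_iff_blk supNorm_eq_dist)
open Literature.MathematicalPhysics.QuantumFieldTheory.Balaban1983to89.B15Ineq147LevelGap (cube CubeSite zoneC)
open Literature.MathematicalPhysics.QuantumFieldTheory.Balaban1983to89.B14DomainGeom (cubeIdx IsUnionOfCubes)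
open Literature.MathematicalPhysics.QuantumFieldTheory.Balaban1983to89.B15LatticeCubeContours (latC latSystem)
open Literature.MathematicalPhysics.QuantumFieldTheory.Balaban1983to89.B6Lemma21PrintedDomains (Cond22 Cond22Sup
  cond22_of_sup sepZd_of_cond22 monotone_compl_of_antitone tiles_printedDomains levelGap_printedDomains
  connected_printedDomains ineq261T_latC_of_sepZd)
open Literature.MathematicalPhysics.QuantumFieldTheory.Balaban1983to89.B6Geometry (ContourSystem Realizes
  ineq260_of_levelGap triangle254_of_realizes LevelGap)
open Literature.MathematicalPhysics.QuantumFieldTheory.Balaban1983to89.B6Prop22KLevelCensus (KIdx)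
open Literature.MathematicalPhysics.QuantumFieldTheory.Balaban1983to89.B6Prop22KLevelCensusEta (geoP)
open Literature.MathematicalPhysics.QuantumFieldTheory.Balaban1983to89.B6 (Geometry Cond259)
open Literature.MathematicalPhysics.QuantumFieldTheory.Balaban1983to89.B6RandomWalk (Ineq260 Triangle254)
open Literature.MathematicalPhysics.QuantumFieldTheory.Balaban1983to89.B6Lemma21Repaired (Ineq261With Ineq262With
  Ineq263With ineq262With_of_261With ineq263With_of_261With)
open Literature.MathematicalPhysics.QuantumFieldTheory.Balaban1983to89.B6Lemma21TwoScale (c1TwoScale)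

noncomputable section

variable {d : ℕ}

/-! ## §1 The coordinate clamp into the box -/

/-- the clamp of an integer into `[0, N)` (`N ≥ 1`): `max 0 (min z (N − 1))`. [cite: Balaban1984PropagatorsII, (2.1) p.224, dictionary] -/
def clamp (N : ℕ) (z : ℤ) : ℤ := max 0 (min z ((N : ℤ) - 1))

/-- `0 ≤ clamp`. [folklore] -/
private theorem clamp_nonneg (N : ℕ) (z : ℤ) : 0 ≤ clamp N z := le_max_left _ _

/-- `clamp < N` for `N ≥ 1`. [folklore] -/
private theorem clamp_lt {N : ℕ} (hN : 1 ≤ N) (z : ℤ) : clamp N z < N := by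
  unfold clamp
  have : ((N : ℤ) - 1) < N := by omega
  simp only [max_lt_iff, min_lt_iff]
  exact ⟨by exact_mod_cast hN, Or.inr this⟩

/-- the clamp is the identity on `[0, N)`. [folklore] -/
private theorem clamp_of_mem {N : ℕ} {z : ℤ} (h0 : 0 ≤ z) (h1 : z < N) : clamp N z = z := by
  unfold clamp
  rw [min_eq_left (by omega), max_eq_right h0]

/-- the clamp is monotone. [folklore] -/
private theorem clamp_mono (N : ℕ) {a b : ℤ} (h : a ≤ b) : clamp N a ≤ clamp N b :=
  max_le_max le_rfl (min_le_min h le_rfl)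

/-- the clamp has slope at most one. [folklore] -/
private theorem clamp_sub_le (N : ℕ) {a b : ℤ} (h : a ≤ b) : clamp N b - clamp N a ≤ b - a := by
  unfold clamp
  simp only [max_def, min_def]
  split_ifs <;> omega

/-- **THE CLAMP IS 1-LIPSCHITZ**: `|clamp a − clamp b| ≤ |a − b|`. [folklore] -/
private theorem abs_clamp_sub_le (N : ℕ) (a b : ℤ) : |clamp N a - clamp N b| ≤ |a - b| := by
  rcases le_total a b with h | h
  · rw [abs_sub_comm, abs_of_nonneg (sub_nonneg.2 (clamp_mono N h)), abs_sub_comm, abs_of_nonneg (sub_nonneg.2 h)]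
    exact clamp_sub_le N h
  · rw [abs_of_nonneg (sub_nonneg.2 (clamp_mono N h)), abs_of_nonneg (sub_nonneg.2 h)]
    exact clamp_sub_le N h

/-- values below the box clamp to `0`. [folklore] -/
private theorem clamp_of_neg {N : ℕ} {z : ℤ} (h : z < 0) : clamp N z = 0 := by
  unfold clamp
  exact max_eq_left (le_trans (min_le_left _ _) h.le)

/-- values above the box clamp to `N − 1`. [folklore] -/
private theorem clamp_of_ge {N : ℕ} {z : ℤ} (h : (N : ℤ) ≤ z) (hN : 1 ≤ N) : clamp N z = N - 1 := by
  unfold clamp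
  rw [min_eq_right (by omega), max_eq_right (by omega)]

/-- the coordinatewise clamp into the box `Π_μ[0, N_μ)`. [cite: Balaban1984PropagatorsII, (2.1) p.224, dictionary] -/
def clampV (N : Fin (d + 1) → ℕ) (x : Fin (d + 1) → ℤ) : Fin (d + 1) → ℤ := fun μ => clamp (N μ) (x μ)

/-- the clamped point is a box site (`N_μ ≥ 1`) — the extension's sites live in the box of (2.1). [cite: Balaban1984PropagatorsII, (2.1) p.224, dictionary] -/
theorem clampV_mem {N : Fin (d + 1) → ℕ} (hN : ∀ μ, 1 ≤ N μ) (x : Fin (d + 1) → ℤ) : clampV N x ∈ boxDom N :=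
  mem_boxDom.2 fun μ => ⟨clamp_nonneg _ _, clamp_lt (hN μ) _⟩

/-- the clamp is the identity on the box — the extension restricts to `D` on (2.1)'s box. [cite: Balaban1984PropagatorsII, (2.1) p.224, dictionary] -/
theorem clampV_of_mem {N : Fin (d + 1) → ℕ} {x : Fin (d + 1) → ℤ} (hx : x ∈ boxDom N) : clampV N x = x := by
  funext μ
  obtain ⟨h0, h1⟩ := mem_boxDom.1 hx μ
  exact clamp_of_mem h0 h1

/-- **THE CLAMP IS 1-LIPSCHITZ IN THE SUP NORM** (the input that transports (2.2) from the box to the extension).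
[cite: Balaban1984PropagatorsII, (2.2) p.224, dictionary] -/
theorem supNorm_clampV_sub_le (N : Fin (d + 1) → ℕ) (a b : Fin (d + 1) → ℤ) :
    supNorm (clampV N a - clampV N b) ≤ supNorm (a - b) := by
  obtain ⟨i, hi⟩ := exists_supNorm_eq (clampV N a - clampV N b)
  rw [hi, Pi.sub_apply]
  refine le_trans ?_ (abs_le_supNorm (a - b) i)
  rw [Pi.sub_apply]
  exact_mod_cast abs_clamp_sub_le (N i) (a i) (b i)

/-- bounds of a point from its cube index: `s·c ≤ z < s·c + s` where `c = z / s`, `s ≥ 1`. [folklore] -/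
private theorem ediv_bounds {s : ℕ} (hs : 1 ≤ s) (z : ℤ) :
    (s : ℤ) * (z / (s : ℤ)) ≤ z ∧ z < (s : ℤ) * (z / (s : ℤ)) + s := by
  have hs' : (0 : ℤ) < s := by exact_mod_cast hs
  have h1 := Int.mul_ediv_add_emod z (s : ℤ)
  have h2 := Int.emod_nonneg z hs'.ne'
  have h3 := Int.emod_lt_of_pos z hs'
  constructor <;> linarith

/-- **THE CLAMP RESPECTS EVERY GRID WHOSE SIDE DIVIDES THE BOX**: two points in one `s`-cube of `ℤ^{d+1}` clamp into one
`s`-cube of the box (`s ∣ N_μ`): cubes inside the box are kept, cubes outside collapse onto a boundary layer of one cube.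
[cite: Balaban1984PropagatorsII, (2.1) p.224 («a sum of big blocks»), dictionary] -/
theorem blk_clampV_eq {N : Fin (d + 1) → ℕ} {s : ℕ} (hs : 1 ≤ s) (hdiv : ∀ μ, s ∣ N μ) (hN : ∀ μ, 1 ≤ N μ)
    {x y : Fin (d + 1) → ℤ} (h : blk s x = blk s y) : blk s (clampV N x) = blk s (clampV N y) := by
  have hs' : (0 : ℤ) < s := by exact_mod_cast hs
  funext μ
  have hc : x μ / (s : ℤ) = y μ / (s : ℤ) := congrFun h μ
  obtain ⟨q, hq⟩ := hdiv μ
  obtain ⟨hx1, hx2⟩ := ediv_bounds hs (x μ)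
  obtain ⟨hy1, hy2⟩ := ediv_bounds hs (y μ)
  set c := x μ / (s : ℤ) with hcdef
  rw [← hc] at hy1 hy2
  simp only [blk, clampV]
  have hNq : ((N μ : ℕ) : ℤ) = (s : ℤ) * q := by rw [hq]; push_cast; ring
  by_cases hneg : c < 0
  · -- the cube lies below the box in this coordinate: both clamp to `0`
    have hx0 : x μ < 0 := by nlinarith
    have hy0 : y μ < 0 := by nlinarith
    rw [clamp_of_neg hx0, clamp_of_neg hy0]
  · push Not at hneg
    by_cases hge : (q : ℤ) ≤ c
    · -- the cube lies above the box: both clamp to `N − 1`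
      have hxN : ((N μ : ℕ) : ℤ) ≤ x μ := by rw [hNq]; nlinarith
      have hyN : ((N μ : ℕ) : ℤ) ≤ y μ := by rw [hNq]; nlinarith
      rw [clamp_of_ge hxN (hN μ), clamp_of_ge hyN (hN μ)]
    · -- the cube lies inside the box: the clamp is the identity
      push Not at hge
      have hc1 : c + 1 ≤ (q : ℤ) := hge
      have hxN : x μ < N μ := by
        rw [hNq]; nlinarith
      have hyN : y μ < N μ := by
        rw [hNq]; nlinarith
      have hx0 : 0 ≤ x μ := le_trans (by positivity) hx1
      have hy0 : 0 ≤ y μ := le_trans (by positivity) hy1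
      rw [clamp_of_mem hx0 hxN, clamp_of_mem hy0 hyN]
      exact hc

/-! ## §2 The extension of a box family to print's setting on `ℤ^{d+1}` -/

section Ext

variable {ℓ Mh k R : ℕ} {P : Fin (d + 1) → ℕ} (D : Domains d ℓ Mh k P R)

/-- the box sides are positive for `M_h, P_μ ≥ 1`. [cite: Balaban1984PropagatorsII, (2.1) p.224, dictionary] -/
theorem one_le_N0 (hMh : 1 ≤ Mh) (hP : ∀ μ, 1 ≤ P μ) : ∀ μ, 1 ≤ N0 ℓ Mh k P μ := fun μ =>
  Nat.one_le_iff_ne_zero.2 (Nat.mul_ne_zero_iff.2 ⟨by positivity,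
    Nat.mul_ne_zero_iff.2 ⟨by omega, Nat.mul_ne_zero_iff.2 ⟨by omega, by have := hP μ; omega⟩⟩⟩)

/-- the big-block side `L^j·M` (`M = L·M_h`) divides the box sides for `j ≤ k`. [cite: Balaban1984PropagatorsII, (2.1) p.224, dictionary] -/
theorem bigSide_dvd_N0 {j : ℕ} (hj : j ≤ k) : ∀ μ, bigSide ℓ Mh j ∣ N0 ℓ Mh k P μ := by
  intro μ
  obtain ⟨t, rfl⟩ := Nat.exists_eq_add_of_le hj
  refine ⟨(ℓ + 1) ^ t * P μ, ?_⟩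
  simp only [N0, bigSide, pow_add, pow_one]
  ring

/-- the block side `L^j` divides the box sides for `j ≤ k`. [cite: Balaban1984PropagatorsII, (2.1) p.224, dictionary] -/
theorem pow_dvd_N0 {j : ℕ} (hj : j ≤ k) : ∀ μ, (ℓ + 1) ^ j ∣ N0 ℓ Mh k P μ := fun μ =>
  dvd_trans ⟨Mh * (ℓ + 1), by simp only [bigSide, pow_succ]; ring⟩ (bigSide_dvd_N0 (ℓ := ℓ) (Mh := Mh) (P := P) hj μ)

/-- **THE EXTENDED LEVEL FUNCTION**: the level of the clamped point. [cite: Balaban1984PropagatorsII, (2.3)–(2.4) p.224, dictionary] -/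
def levExt (x : Fin (d + 1) → ℤ) : ℕ := D.lev (clampV (N0 ℓ Mh k P) x)

/-- **THE EXTENDED DOMAINS `Ω_j = {j ≤ levExt}`** on `ℤ^{d+1}` (so `Ω₀ = Ω₁ = ℤ^{d+1} ⊃ Ω₂ ⊃ … ⊃ Ω_k ⊃ Ω_{k+1} = ∅`).
[cite: Balaban1984PropagatorsII, (2.1), (2.3)–(2.4) p.224] -/
def OmExt (j : ℕ) : Set (Fin (d + 1) → ℤ) := {x | j ≤ levExt D x}

/-- the zones `Z_j = Ω_jᶜ` of p29's carrier. [cite: Balaban1984PropagatorsII, (2.3) p.224, dictionary] -/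
abbrev ZExt : ℕ → Set (Fin (d + 1) → ℤ) := fun j => (OmExt D j)ᶜ

/-- membership in `Ω_j`. [cite: Balaban1984PropagatorsII, (2.1) p.224, dictionary] -/
@[simp] theorem mem_OmExt {j : ℕ} {x : Fin (d + 1) → ℤ} : x ∈ OmExt D j ↔ j ≤ levExt D x := Iff.rfl

/-- the extension agrees with `D.lev` on the box. [cite: Balaban1984PropagatorsII, (2.3) p.224, dictionary] -/
theorem levExt_of_mem {x : Fin (d + 1) → ℤ} (hx : x ∈ boxDom (N0 ℓ Mh k P)) : levExt D x = D.lev x := by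
  unfold levExt; rw [clampV_of_mem hx]

/-- (2.1) «Ω₁ ⊃ Ω₂ ⊃ …»: the extended domains are nested. [cite: Balaban1984PropagatorsII, (2.1) p.224] -/
theorem antitone_OmExt : Antitone (OmExt D) := fun _ _ hij _ hx => le_trans hij hx

/-- `Ω₀ = ℤ^{d+1}` (print: «Ω_j = T_η for j ≤ l» — here also `Ω₁ = ℤ^{d+1}`). [cite: Balaban1984PropagatorsII, p.224] -/
theorem OmExt_zero : OmExt D 0 = Set.univ := Set.eq_univ_of_forall fun _ => Nat.zero_le _

/-- `Ω₁ = ℤ^{d+1}`: no level `0` in the `k`-level lane. [cite: Balaban1984PropagatorsII, p.224 («Ω_j = T_η for j = 1, …, l»)] -/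
theorem OmExt_one : OmExt D 1 = Set.univ := Set.eq_univ_of_forall fun _ => D.one_le_lev _

/-- `Ω_{k+1} = ∅`: `k` levels. [cite: Balaban1984PropagatorsII, (2.1) p.224] -/
theorem OmExt_succ : OmExt D (k + 1) = ∅ :=
  Set.eq_empty_of_forall_notMem fun x hx => absurd (le_trans hx (D.lev_le _)) (by omega)

/-- **(2.1) FOR THE EXTENSION: every `Ω_j` is a union of `LʲM`-cubes** (`M = L·M_h`), in p29's typing `IsUnionOfCubes`.
[cite: Balaban1984PropagatorsII, (2.1) p.224 («Ω_j^{(j)} … is a sum of big blocks»)] -/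
theorem isUnionOfCubes_OmExt (hMh : 1 ≤ Mh) (hP : ∀ μ, 1 ≤ P μ) :
    ∀ j, IsUnionOfCubes ((ℓ + 1) ^ j * ((ℓ + 1) * Mh)) (OmExt D j) := by
  intro j x y hxy
  simp only [mem_OmExt]
  rcases Nat.lt_or_ge j 2 with hj | hj
  · -- `j ≤ 1`: both sides hold
    exact ⟨fun _ => le_trans (by omega) (D.one_le_lev _), fun _ => le_trans (by omega) (D.one_le_lev _)⟩
  rcases Nat.lt_or_ge k j with hjk | hjk
  · -- `j > k`: both sides fail
    exact ⟨fun h => absurd (le_trans h (D.lev_le _)) (by omega), fun h => absurd (le_trans h (D.lev_le _)) (by omega)⟩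
  -- `2 ≤ j ≤ k`: the big `j`-blocks of the clamped points coincide, and (2.1) of `D` decides membership blockwise
  have hside : (ℓ + 1) ^ j * ((ℓ + 1) * Mh) = bigSide ℓ Mh j := by simp only [bigSide, pow_succ]; ring
  have hblk : blk (bigSide ℓ Mh j) x = blk (bigSide ℓ Mh j) y := by
    rw [← hside]; exact hxy
  have hN := one_le_N0 (ℓ := ℓ) (k := k) hMh hP
  have hc := blk_clampV_eq (B6MultiLevelBoxOperator.one_le_bigSide hMh j) (bigSide_dvd_N0 hjk) hN hblk
  unfold levExt
  exact D.bigBlocks j hj _ (clampV_mem hN x) _ (clampV_mem hN y) hc.symm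

/-- p21's and p29's casts of a lattice point to `ℝ^{d+1}` agree. [folklore] -/
private theorem toR_eq (x : Fin (d + 1) → ℤ) : B6Geom246MultiLevelBox.toR x = B15Ineq147LevelGap.toR x := rfl

/-- **(2.2) FOR THE EXTENSION, SUP-NORM READING WITH PRINT'S THRESHOLD `RM`**: a point outside `Ω_j` and a point of
`Ω_{j+1}` are more than `RM·L^j` apart (`M = L·M_h`) — from `Domains.sep` through the 1-Lipschitz clamp.
[cite: Balaban1984PropagatorsII, (2.2) p.224] -/
theorem cond22Sup_OmExt (hMh : 1 ≤ Mh) (hP : ∀ μ, 1 ≤ P μ) :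
    Cond22Sup (OmExt D) (ℓ + 1) ((R * ((ℓ + 1) * Mh) : ℕ) : ℝ) := by
  intro j a b ha hb
  simp only [mem_OmExt, not_le] at ha hb
  have hN := one_le_N0 (ℓ := ℓ) (k := k) hMh hP
  have hsep := D.sep j _ (clampV_mem hN a) _ (clampV_mem hN b) ha hb
  have hside : ((R * bigSide ℓ Mh j : ℕ) : ℝ) = ((R * ((ℓ + 1) * Mh) : ℕ) : ℝ) * ((ℓ + 1 : ℕ) : ℝ) ^ j := by
    simp only [bigSide]; push_cast; ring
  rw [← toR_eq, ← toR_eq, ← supNorm_eq_dist]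
  calc ((R * ((ℓ + 1) * Mh) : ℕ) : ℝ) * ((ℓ + 1 : ℕ) : ℝ) ^ j = ((R * bigSide ℓ Mh j : ℕ) : ℝ) := hside.symm
    _ < supNorm (clampV (N0 ℓ Mh k P) a - clampV (N0 ℓ Mh k P) b) := hsep
    _ ≤ supNorm (a - b) := supNorm_clampV_sub_le _ a b

/-- (2.2) in p29's ℓ¹ form with the integer count `RM = R·(L·M_h)`. [cite: Balaban1984PropagatorsII, (2.2) p.224] -/
theorem cond22_OmExt (hMh : 1 ≤ Mh) (hP : ∀ μ, 1 ≤ P μ) : Cond22 (OmExt D) (ℓ + 1) (R * ((ℓ + 1) * Mh)) :=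
  cond22_of_sup (cond22Sup_OmExt D hMh hP) le_rfl

end Ext

/-! ## §3 The blocks `𝔅` of the box are print's base points (cube-sites of the extension) -/

section Embed

variable {ℓ Mh k R : ℕ} {P : Fin (d + 1) → ℕ} (D : Domains d ℓ Mh k P R)

/-- **EVERY POINT OF THE `Lʲ`-CUBE OF A BLOCK `(j, y) ∈ 𝔅` IS A BOX SITE OF THAT BLOCK** (blocks do not straddle `∂X`:
`Lʲ ∣ N₀`). [cite: Balaban1984PropagatorsII, (2.1) p.224, dictionary] -/
theorem mem_box_of_mem_cube (s : ↥(bset D)) {x : Fin (d + 1) → ℤ}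
    (hx : x ∈ cube 1 (ℓ + 1) s.1.1 s.1.2) : x ∈ boxDom (N0 ℓ Mh k P) ∧ blk ((ℓ + 1) ^ s.1.1) x = s.1.2 := by
  obtain ⟨x₀, hx₀⟩ := exists_blkOf_eq D s
  have hjk : s.1.1 ≤ k := (B6Geom246MultiLevelBox.scale_bounds D s).2
  have hbox₀ := mem_boxDom.1 x₀.2
  have hside : ((1 * (ℓ + 1) ^ s.1.1 : ℕ) : ℤ) = (((ℓ + 1) ^ s.1.1 : ℕ) : ℤ) := by push_cast; ring
  have hn : (0 : ℤ) < (((ℓ + 1) ^ s.1.1 : ℕ) : ℤ) := by positivity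
  have hmem : x ∈ boxDom (N0 ℓ Mh k P) := by
    rw [mem_boxDom]
    intro μ
    obtain ⟨h1, h2⟩ := hx μ
    rw [hside] at h1 h2
    obtain ⟨h1₀, h2₀⟩ := coord_bounds D hx₀ μ
    obtain ⟨hlo, hhi⟩ := hbox₀ μ
    -- `y_μ ≥ 0` since `0 ≤ x₀_μ < L^j(y_μ + 1)`
    have hy : 0 ≤ s.1.2 μ := by
      by_contra hneg
      push Not at hneg
      nlinarith
    -- `L^j(y_μ + 1) ≤ N₀_μ` since `L^j y_μ ≤ x₀_μ < N₀_μ = L^j·q`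
    obtain ⟨q, hq⟩ := pow_dvd_N0 (ℓ := ℓ) (Mh := Mh) (P := P) hjk μ
    have hNq : ((N0 ℓ Mh k P μ : ℕ) : ℤ) = (((ℓ + 1) ^ s.1.1 : ℕ) : ℤ) * q := by rw [hq]; push_cast; ring
    have hyq : s.1.2 μ < q := by
      by_contra hge
      push Not at hge
      have : (((ℓ + 1) ^ s.1.1 : ℕ) : ℤ) * q ≤ (((ℓ + 1) ^ s.1.1 : ℕ) : ℤ) * s.1.2 μ := by nlinarith
      linarith
    constructor
    · nlinarith
    · rw [hNq]; nlinarith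
  refine ⟨hmem, ?_⟩
  have h := (B15TouchingCubeContours.mem_cube_iff_cubeIdx (M₁ := 1) (L := ℓ + 1)
    (Nat.mul_pos Nat.one_pos (Nat.pow_pos (by omega)))).1 hx
  rw [← h]
  funext μ
  simp only [blk, cubeIdx]
  push_cast
  ring_nf

/-- every point of the cube of a block `(j, y) ∈ 𝔅` has extended level `j`. [cite: Balaban1984PropagatorsII, (2.3)–(2.4) p.224] -/
theorem levExt_of_mem_cube (s : ↥(bset D)) {x : Fin (d + 1) → ℤ} (hx : x ∈ cube 1 (ℓ + 1) s.1.1 s.1.2) :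
    levExt D x = s.1.1 := by
  obtain ⟨hmem, hblk⟩ := mem_box_of_mem_cube D s hx
  rw [levExt_of_mem D hmem]
  exact lev_eq_of_blkOf_eq D ((blkOf_eq_iff_blk D (x := ⟨x, hmem⟩) (s := s)).2 hblk)

/-- **THE EMBEDDING `𝔅 ↪ CubeSite`**: the block `(j, y)` IS the cube-site `(j, y)` of the extension (its `Lʲ`-cube lies in
the territory `B^j(Λ_j) = Z_{j+1} ∖ Z_j`). [cite: Balaban1984PropagatorsII, (2.45) p.231 («𝔅 = ⋃_j Λ_j»)] -/
def iota (s : ↥(bset D)) : CubeSite 1 (ℓ + 1) (ZExt D) :=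
  ⟨(s.1.1, s.1.2), fun x hx => by
    have h := levExt_of_mem_cube D s hx
    refine ⟨fun h1 => ?_, fun h2 => h2 ?_⟩
    · have h1' : s.1.1 + 1 ≤ levExt D x := h1
      omega
    · show s.1.1 ≤ levExt D x
      omega⟩

/-- the embedding is injective. [cite: Balaban1984PropagatorsII, (2.45) p.231, dictionary] -/
theorem iota_injective : Function.Injective (iota D) := by
  intro s t h
  have h1 : (iota D s).1 = (iota D t).1 := congrArg Subtype.val h
  simp only [iota, Prod.mk.injEq] at h1
  exact Subtype.ext (Prod.ext h1.1 h1.2)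

/-- zone of the embedded block = its level. [cite: Balaban1984PropagatorsII, (2.45) p.231, dictionary] -/
@[simp] theorem zoneC_iota (s : ↥(bset D)) : zoneC (iota D s) = s.1.1 := rfl

end Embed

/-! ## §4 The R0 geometry of the box: print's distance (2.46) read literally -/

section GeomR0

variable {ℓ Mh k R : ℕ} {P : Fin (d + 1) → ℕ} (D : Domains d ℓ Mh k P R)

/-- **THE R0 GEOMETRY OF THE BOX FAMILY**: sites `𝔅`, scale = level, `dist` = the lattice-contour distance (2.46) of the
extension between the embedded blocks (reading R0 of GAPS G-B6-22), print's parameters `R` and `M = L·M_h`, `η = 1`.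
[cite: Balaban1984PropagatorsII, (2.45)–(2.46) p.231, (2.1)–(2.2) p.224] -/
def geomR0 : Geometry :=
  { geom D with
    dist := fun s t => (((latC 1 (ℓ + 1) (ZExt D)).dist (iota D s) (iota D t) : ℕ) : ℝ)
    R := R
    M := ((ℓ : ℝ) + 1) * Mh }

/-- the sites of `geomR0 D` are the blocks `𝔅`. [cite: Balaban1984PropagatorsII, (2.45) p.231, dictionary] -/
@[simp] theorem geomR0_Site : (geomR0 D).Site = ↥(bset D) := rfl
/-- `dist` unfolded. [cite: Balaban1984PropagatorsII, (2.46) p.231, dictionary] -/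
theorem geomR0_dist (s t : ↥(bset D)) :
    (geomR0 D).dist s t = (((latC 1 (ℓ + 1) (ZExt D)).dist (iota D s) (iota D t) : ℕ) : ℝ) := rfl
/-- `R` = print's `R`. [cite: Balaban1984PropagatorsII, (2.2) p.224, dictionary] -/
@[simp] theorem geomR0_R : (geomR0 D).R = R := rfl
/-- `M` = print's `M = L·M_h`. [cite: Balaban1984PropagatorsII, (2.2) p.224, dictionary] -/
@[simp] theorem geomR0_M : (geomR0 D).M = ((ℓ : ℝ) + 1) * Mh := rfl
/-- `scale` = level. [cite: Balaban1984PropagatorsII, (2.45) p.231, dictionary] -/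
@[simp] theorem geomR0_scale (s : ↥(bset D)) : (geomR0 D).scale s = s.1.1 := rfl

/-- the contour system realising `geomR0 D`: p29's cube-sites and lattice-contour graph, the embedding `iota`.
[cite: Balaban1984PropagatorsII, (2.46) p.231] -/
@[reducible] def csysR0 : ContourSystem (geomR0 D) := latSystem (g := geomR0 D) (iota D) fun _ => rfl

/-- `geomR0 D` is realised by `csysR0 D` ((2.46) by definition). [cite: Balaban1984PropagatorsII, (2.46) p.231] -/
theorem realizes_geomR0 : Realizes (geomR0 D) (csysR0 D) := fun _ _ => rfl

/-- **ADMISSIBLE CONTOURS EXIST** on the extension («Of course the infimum is attained at some contour Γ_{y,y′}»).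
[cite: Balaban1984PropagatorsII, (2.46) p.231, (2.4) p.224] -/
theorem connected_R0 (hℓ : 1 ≤ ℓ) (hMh : 1 ≤ Mh) (hR : 1 ≤ R) (hP : ∀ μ, 1 ≤ P μ) :
    (latC 1 (ℓ + 1) (ZExt D)).Connected := by
  have hRM : 1 ≤ R * ((ℓ + 1) * Mh) := Nat.mul_pos hR (Nat.mul_pos (by omega) hMh)
  exact connected_printedDomains (antitone_OmExt D) (OmExt_zero D) (OmExt_succ D) (isUnionOfCubes_OmExt D hMh hP)
    (cond22_OmExt D hMh hP) hRM (by omega)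

/-- **(2.57) WITH PRINT'S `RM`**: a contour from a block below level `i` to a block above level `i` has more than
`R·M` bonds. [cite: Balaban1984PropagatorsII, (2.57) p.233, (2.2) p.224] -/
theorem levelGap_R0 (hMh : 1 ≤ Mh) (hP : ∀ μ, 1 ≤ P μ) :
    LevelGap (latC 1 (ℓ + 1) (ZExt D)) zoneC (R * ((ℓ + 1) * Mh)) :=
  levelGap_printedDomains (antitone_OmExt D) (cond22_OmExt D hMh hP) (by omega)

/-- **(2.54)**: the triangle inequality of the R0 distance on `𝔅`. [cite: Balaban1984PropagatorsII, (2.54) p.233] -/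
theorem triangle254_R0 (hℓ : 1 ≤ ℓ) (hMh : 1 ≤ Mh) (hR : 1 ≤ R) (hP : ∀ μ, 1 ≤ P μ) : Triangle254 (geomR0 D) :=
  triangle254_of_realizes (realizes_geomR0 D) (connected_R0 D hℓ hMh hR hP)

/-- `d(y, y) = 0` and `d ≥ 0` for the R0 distance. [cite: Balaban1984PropagatorsII, (2.46) p.231] -/
theorem dist_R0_self_nonneg (s t : ↥(bset D)) : (geomR0 D).dist s s = 0 ∧ 0 ≤ (geomR0 D).dist s t := by
  refine ⟨?_, Nat.cast_nonneg _⟩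
  rw [geomR0_dist, SimpleGraph.dist_self, Nat.cast_zero]

end GeomR0

/-! ## §5 Lemma 2.1 (2.60)–(2.63) with c₁″ and print's distance for the genuine `k`-level box family -/

section Lemma21

variable {ℓ Mh k R : ℕ} {P : Fin (d + 1) → ℕ} (D : Domains d ℓ Mh k P R)

/-- **LEMMA 2.1 FOR THE GENUINE `k`-LEVEL BOX FAMILY, PRINT'S DISTANCE (2.46) READ LITERALLY, THE d-ONLY CONSTANT
c₁″ = 13c₀(½α)^{4(d+1)}**: for every nested family `D` of the box (any `k`, volume `P`, `M_h, R ≥ 1`, `L ≥ 2`), every `δ₀ > 0`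
and every `0 < α < 1` with (2.59) `¼αδ₀RM > 2(d+1) log c₀(½α) + 1` for PRINT'S `R` and `M = L·M_h`:  (2.60) ∧ (2.61″) ∧ (2.62″)
∧ (2.63″) on `geomR0 D` — p29's Lemma 2.1 for print's own domains pulled back along `iota`.
[cite: Balaban1984PropagatorsII, Lemma 2.1 (2.60)–(2.63) p.234, (2.59) p.233, (2.46) p.231, (2.1)–(2.2) p.224; corrected] -/
theorem lemma21R0_multiLevelBox (hℓ : 1 ≤ ℓ) (hMh : 1 ≤ Mh) (hR : 1 ≤ R) (hP : ∀ μ, 1 ≤ P μ) {δ₀ : ℝ}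
    (hδ : 0 < δ₀) {α : ℝ} (hα0 : 0 < α) (hα1 : α < 1)
    (h259 : Cond259 (d + 1) δ₀ α (geomR0 D).R (geomR0 D).M) :
    Ineq260 (geomR0 D) δ₀ α ∧ Ineq261With (c1TwoScale (d + 1) δ₀ α) (geomR0 D) δ₀ α ∧
      Ineq262With (c1TwoScale (d + 1) δ₀ α) (geomR0 D) δ₀ α ∧
      Ineq263With (c1TwoScale (d + 1) δ₀ α) (geomR0 D) δ₀ α := by
  have hL2 : 2 ≤ ℓ + 1 := by omega
  have hRM1 : 1 ≤ R * ((ℓ + 1) * Mh) := Nat.mul_pos hR (Nat.mul_pos (by omega) hMh)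
  have hN : 2 ≤ R * ((ℓ + 1) * Mh) :=
    le_trans (by omega : 2 ≤ 1 * (2 * 1)) (Nat.mul_le_mul hR (Nat.mul_le_mul hL2 hMh))
  have hRM : (geomR0 D).R * (geomR0 D).M ≤ ((R * ((ℓ + 1) * Mh) : ℕ) : ℝ) := by
    rw [geomR0_R, geomR0_M]; push_cast; exact le_of_eq (by ring)
  have hanti := antitone_OmExt D
  have h22 := cond22_OmExt D hMh hP
  have hconn := connected_R0 D hℓ hMh hR hP
  have hreal := realizes_geomR0 D
  have h260 : Ineq260 (geomR0 D) δ₀ α :=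
    ineq260_of_levelGap (C := csysR0 D) hreal hconn (levelGap_R0 D hMh hP) hRM (mul_pos hα0 hδ).le
  have h261 : Ineq261With (c1TwoScale (d + 1) δ₀ α) (geomR0 D) δ₀ α :=
    ineq261T_latC_of_sepZd (g := geomR0 D) (iota D) (iota_injective D) (fun _ => rfl) (fun _ _ => rfl)
      (monotone_compl_of_antitone hanti) (sepZd_of_cond22 h22)
      (tiles_printedDomains (by omega) (isUnionOfCubes_OmExt D hMh hP) (OmExt_zero D) (OmExt_succ D))
      Nat.one_pos hL2 hRM hN hα0 hδ h259
  exact ⟨h260, h261, ineq262With_of_261With h261,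
    ineq263With_of_261With (triangle254_R0 D hℓ hMh hR hP) hδ.le hα1.le h261⟩

/-- the same with (2.59) written on print's `R` and `M = L·M_h` as numbers. [cite: Balaban1984PropagatorsII, Lemma 2.1 p.234, (2.59) p.233; corrected] -/
theorem lemma21R0_multiLevelBox' (hℓ : 1 ≤ ℓ) (hMh : 1 ≤ Mh) (hR : 1 ≤ R) (hP : ∀ μ, 1 ≤ P μ) {δ₀ : ℝ}
    (hδ : 0 < δ₀) {α : ℝ} (hα0 : 0 < α) (hα1 : α < 1)
    (h259 : Cond259 (d + 1) δ₀ α R (((ℓ : ℝ) + 1) * Mh)) :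
    Ineq260 (geomR0 D) δ₀ α ∧ Ineq261With (c1TwoScale (d + 1) δ₀ α) (geomR0 D) δ₀ α ∧
      Ineq262With (c1TwoScale (d + 1) δ₀ α) (geomR0 D) δ₀ α ∧
      Ineq263With (c1TwoScale (d + 1) δ₀ α) (geomR0 D) δ₀ α :=
  lemma21R0_multiLevelBox D hℓ hMh hR hP hδ hα0 hα1 h259

end Lemma21

/-! ## §6 The `B6Lemma21Param` shape on the census family `KIdx` (print's units) -/

section Family

variable {ℓ : ℕ} (i : KIdx d ℓ)

/-- **THE R0 CENSUS GEOMETRY OF A MEMBER**: `B6Prop22KLevelCensusEta.geoP i` (the genuine `k`-level member in print's units,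
`M = L·M_h`, `R`, the localisation vocabulary) with `dist` replaced by the R0 distance of `geomR0 i.D`.
[cite: Balaban1984PropagatorsII, (2.45)–(2.46) p.231, (2.1)–(2.2) p.224] -/
def geoR0P : Geometry :=
  { geoP i with dist := (geomR0 i.D).dist }

/-- the sites are the blocks `𝔅` of the member. [cite: Balaban1984PropagatorsII, (2.45) p.231, dictionary] -/
@[simp] theorem geoR0P_Site : (geoR0P i).Site = ↥(bset i.D) := rfl
/-- `dist` = the R0 distance. [cite: Balaban1984PropagatorsII, (2.46) p.231, dictionary] -/
theorem geoR0P_dist (s t : ↥(bset i.D)) : (geoR0P i).dist s t = (geomR0 i.D).dist s t := rfl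
/-- `R` = the member's `R`. [cite: Balaban1984PropagatorsII, (2.2) p.224, dictionary] -/
@[simp] theorem geoR0P_R : (geoR0P i).R = i.R := rfl
/-- `M = L·M_h`. [cite: Balaban1984PropagatorsII, (2.2) p.224, dictionary] -/
@[simp] theorem geoR0P_M : (geoR0P i).M = ((ℓ : ℝ) + 1) * i.Mh := rfl
/-- all other census fields (`scale`, `eta`, `len`, `Loc`, `suppIn`, `supNorm`, `holder`, `Cut`, `cutIn`, `cutH`) are those of
`geoP i`. [cite: Balaban1984PropagatorsII, Prop. 2.2 p.234, dictionary] -/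
theorem geoR0P_len (s : ↥(bset i.D)) : (geoR0P i).len s = (geoP i).len s := rfl

/-- **LEMMA 2.1 ON A CENSUS MEMBER WITH THE R0 DISTANCE** (all four displays, c₁″, any `δ₀ > 0`).
[cite: Balaban1984PropagatorsII, Lemma 2.1 (2.60)–(2.63) p.234; corrected] -/
theorem lemma21_geoR0P (hℓ : 1 ≤ ℓ) {δ₀ : ℝ} (hδ : 0 < δ₀) {α : ℝ} (hα0 : 0 < α) (hα1 : α < 1)
    (h259 : Cond259 (d + 1) δ₀ α (geoR0P i).R (geoR0P i).M) :
    Ineq260 (geoR0P i) δ₀ α ∧ Ineq261With (c1TwoScale (d + 1) δ₀ α) (geoR0P i) δ₀ α ∧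
      Ineq262With (c1TwoScale (d + 1) δ₀ α) (geoR0P i) δ₀ α ∧
      Ineq263With (c1TwoScale (d + 1) δ₀ α) (geoR0P i) δ₀ α :=
  lemma21R0_multiLevelBox i.D hℓ i.hMh (le_trans (by omega) i.hR) i.hP hδ hα0 hα1 h259

/-- **THE `DagBinding.B6Lemma21Param` SHAPE ON THE GENUINE `k`-LEVEL FAMILY** (R0 distance, print's units): for every
`δ₀ > 0` there is ONE function `c₁` of `α` (here c₁″ = 13c₀(½α)^{4(d+1)}, d-only) such that for EVERY member — every `k`,
volume, `M_h`, `R ≥ 2L` and nested family (2.1)–(2.2) — and every `0 < α < 1` with (2.59) for the member's `R`, `M`: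
(2.60) ∧ (2.61″).  Verbatim the body of `DagBinding.B6Lemma21Param` with `D.I := KIdx d ℓ`, `D.geo := geoR0P`, `D.d := d + 1`.
[cite: Balaban1984PropagatorsII, Lemma 2.1 (2.60)–(2.61) p.234, (2.59) p.233; corrected] -/
theorem lemma21Param_kLevelR0 (d ℓ : ℕ) (hℓ : 1 ≤ ℓ) {δ₀ : ℝ} (hδ : 0 < δ₀) :
    ∃ c₁ : ℝ → ℝ, ∀ i : KIdx d ℓ, (geoR0P i).Hyp21_22 → ∀ α : ℝ, 0 < α → α < 1 →
      Cond259 (d + 1) δ₀ α (geoR0P i).R (geoR0P i).M →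
        Ineq260 (geoR0P i) δ₀ α ∧ Ineq261With (c₁ α) (geoR0P i) δ₀ α :=
  ⟨fun α => c1TwoScale (d + 1) δ₀ α, fun i _ _ hα0 hα1 h259 =>
    let h := lemma21_geoR0P i hℓ hδ hα0 hα1 h259
    ⟨h.1, h.2.1⟩⟩

/-- **NON-VACUITY**: the census family has members beyond every threshold on `M` (gen 12's witness
`B6Prop22KLevelCensus.kLevel_nonvacuous` is about `KIdx`; here only the inhabitedness of the index type is recorded, by the
trivial nested family `Ω₁ = … = Ω_k = X`). [cite: Balaban1984PropagatorsII, (2.1) p.224 («Ω_j = T_η for j = 1, …, l»)] -/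
theorem kIdx_nonempty (d ℓ : ℕ) : Nonempty (KIdx d ℓ) :=
  ⟨{ k := 1, Mh := 1, R := 2 * (ℓ + 1), P := fun _ => 1,
     D := Domains.top d ℓ 1 1 (fun _ => 1) (2 * (ℓ + 1)) le_rfl,
     hk := le_rfl, hMh := le_rfl, hR := le_rfl, hP := fun _ => le_rfl }⟩

end Family

end

end Literature.MathematicalPhysics.QuantumFieldTheory.Balaban1983to89.B6Lemma21R0MultiLevelBox
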